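import Literature.Probability.LatticeModels.RandomClusterFiniteVolumePressure
import Literature.Probability.Percolation.BernoulliPercolation
import Mathlib.Algebra.BigOperators.Field
import HarnessLib

/-!
# FK-continuity cell, FO-10a: the number of open clusters is the sum of the inverse cluster sizes,
# `k(ω) = ∑_x |C_x(ω)|⁻¹` (Grimmett 2006, proof of Thm. (4.58), display after (4.82))

Registered R89 (cell INBOX l.6394, 2026-08-24); registry row FO-10a-g338k; label KAP-A (coordinator fk-4 g195).
Cell `fk-continuity` (bschramm), row FO-10a; support file for the FK-continuity transplant
(`--supports stmt-CriticalPhenomena-4575`); builds on p205010 (kernel theorem, internal audit signed;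
external expert review pending). Pure proofs; no definitions, no named facts, no sorries.

On a finite vertex type, double counting over the connected components of the open graph gives
`clusterCount ω ∅ = ∑_{x : V} ((openCluster ω x).ncard)⁻¹` (as real numbers; the cluster is the support of the
connected component, Literature `openCluster_eq_supp`). This is the identity
`k(ω, Λ) = ∑_{x ∈ Λ} 1 / |C_x ∩ Λ|` of Grimmett's proof of Thm. (4.58) (κ-direction, (4.82)–(4.83)), the
first step towards the one-sided `κ`-derivatives (4.84) of the pressure.

## References
* G. Grimmett, *The Random-Cluster Model*, Springer 2006 (`book:grimmett2006-random-cluster-model`): §4.5,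
  proof of Thm. (4.58), (4.81)–(4.84) [PDF p. 94]. [Grimmett2006]
-/

noncomputable section

open scoped Classical
open Finset

namespace Summit.CriticalPhenomena.PercolationContinuityZ3.Theorems.FK

open Literature.Probability.Percolation Literature.Probability.LatticeModels

variable {V : Type*} [Fintype V]

/-- Double counting over connected components: for a graph `H` on a finite vertex type,
`∑_x |supp (component of x)|⁻¹ = #components`. [folklore; cite: Grimmett2006, proof of Thm. (4.58)] -/
theorem sum_inv_ncard_supp_connectedComponentMk_eq (H : SimpleGraph V) :
    ∑ x : V, (((H.connectedComponentMk x).supp.ncard : ℝ))⁻¹ = Nat.card H.ConnectedComponent := by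
  classical
  rw [← Fintype.sum_fiberwise (fun x : V => H.connectedComponentMk x)
    (fun x : V => (((H.connectedComponentMk x).supp.ncard : ℝ))⁻¹)]
  rw [Nat.card_eq_fintype_card, ← Finset.card_univ, Finset.card_eq_sum_ones, Nat.cast_sum, Nat.cast_one]
  refine Finset.sum_congr rfl fun c _ => ?_
  have hsupp : ∀ y : {x : V // H.connectedComponentMk x = c}, (H.connectedComponentMk y.1).supp = c.supp :=
    fun y => by rw [y.2]
  simp_rw [hsupp]
  rw [Finset.sum_const, nsmul_eq_mul, Finset.card_univ]
  have hcard : Fintype.card {x : V // H.connectedComponentMk x = c} = c.supp.ncard := by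
    rw [Set.ncard_eq_toFinset_card', Fintype.card_subtype]
    congr 1
    ext x
    simp only [Finset.mem_filter, Finset.mem_univ, true_and, Set.mem_toFinset,
      SimpleGraph.ConnectedComponent.mem_supp_iff]
  have hpos : 0 < c.supp.ncard := by
    induction c using SimpleGraph.ConnectedComponent.ind with
    | h v =>
      rw [Set.ncard_pos (Set.toFinite _)]
      exact ⟨v, rfl⟩
  rw [hcard, mul_inv_cancel₀]
  exact_mod_cast hpos.ne'

/-- **`k(ω) = ∑_x |C_x(ω)|⁻¹`**: the free cluster count of a configuration on a finite vertex type is the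
sum over the vertices of the inverse sizes of their open clusters.
[cite: Grimmett2006, proof of Thm. (4.58), display after (4.82)] -/
theorem clusterCount_empty_eq_sum_inv_ncard_openCluster (ω : BondConfig V) :
    (clusterCount ω ∅ : ℝ) = ∑ x : V, (((openCluster ω x).ncard : ℝ))⁻¹ := by
  simp_rw [openCluster_eq_supp]
  rw [sum_inv_ncard_supp_connectedComponentMk_eq, clusterCount, wired_empty, sup_bot_eq]

end Summit.CriticalPhenomena.PercolationContinuityZ3.Theorems.FK

end
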